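import Literature.NumberTheory.GaloisCohomology.Howard2004.DVRKolyvaginBound
import HarnessLib

/-!
# Howard 2004, Theorem 1.6.1 AS INTENDED BY ITS PRINTED PROOF — the discrete-valuation-ring Kolyvagin
# bound for coefficient rings of MIXED characteristic (`p ≠ 0` in `R`) over imaginary quadratic `K` with
# `p ∤ #𝓞_K^×`: the honest WEAKER twin F-161′ of the verbatim fact `thm161_dvrKolyvaginBound` (F-161)

Topic `NumberTheory/GaloisCohomology/Howard2004` (cell `pub/bsd-print-x9`, literature seat g45; minted on the cell
referee's READING RULINGS REF-167 «HD-STANDING» (2026-08-29T07:42Z) and REF-169 «HP0-STANDING» (08:33Z),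
recommendation (d): «pen/lit restate F-161′ := F-161 + `(hp0 : ((p:ℕ):R) ≠ 0)` + `(hu : ¬ p ∣ Nat.card (𝓞 K)ˣ)` as
"= print-as-intended, weaker than print-as-worded (honest)"»).  ONE named fact (`def … : Prop`, D-0014; nothing
asserted; debt +1 until the G87 engine's closing theorem discharges it) and ONE kernel one-liner
(`…_of_thm161 : thm161_dvrKolyvaginBound → thm161_dvrKolyvaginBound_printIntended`, the weakening).  The verbatim
fact `thm161_dvrKolyvaginBound` and its file are BYTE-UNTOUCHED (this is a new leaf file; no importer rebuild).
HONEST FRAMING: typed ≠ proved ≠ endorsed; neither F-161 nor F-161′ is proved here; no summit statement is proved;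
BSD is not proved by any of this.

B. Howard, *The Heegner point Kolyvagin system*, Compositio Math. **140** (2004) 1439–1472 = arXiv:1202.6340v1
(held, `paper:arxiv-1202.6340`; arXiv §2.x = Compositio §1.x) [Howard2004HeegnerKolyvagin].

## Print-as-worded vs print-as-intended (why two constants)

* **As worded** (= `thm161_dvrKolyvaginBound`, lit g30, REF-131/132): Thm. 1.6.1 [arXiv Thm. 2.6.1, p0011 L17–32]
  stands under §1's «By a coefficient ring, `R`, we mean a complete, Noetherian, local ring with finite residue field
  of characteristic `p`» [p0004 L47–49] + «Throughout this subsection `R` is a fixed discrete valuation ring with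
  uniformizing parameter `π`» [p0011 L17–18] and §1's «a quadratic imaginary field `K`» [p0005 L3–4] — NO
  characteristic clause on `R`, NO discriminant / unit clause on `K`.  The tree's fact is typed exactly so (every DVR
  coefficient ring, every imaginary quadratic `K`): R2-G44 met, reviewer / referee police PASS.
* **As intended by the printed proof** (cell referee, two annotated PRINT GAPS, no RETURN of the verbatim fact):
  (1) «How04-2.6.1@eqchar» — «The cases of interest are when `R` is the ring of integers `𝒪` of a finite extension of
  `ℚ_p`, a quotient of `𝒪`, or the Iwasawa algebra `Λ`» [p0004 L49–51]; Def. 1.2.1 keys the Kolyvagin primes by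
  `p`-POWERS, «`𝓛_k(T) = {ℓ ∈ 𝓛₀ ∣ I_ℓ ⊂ p^k ℤ_p}`» [p0006 L69–70], while the proof runs on the levels `R/𝔪^k`
  [p0011 L36–38]; comparing `𝔪`-powers with `(p^s)` needs `p ≠ 0` in `R` — in an equal-characteristic DVR (`𝔽_q⟦t⟧`,
  formally a coefficient ring) `𝓛_s(T)` degenerates and the printed choice of Kolyvagin primes (Lemmas 1.6.2/1.6.4)
  is void (x10b-p1-w6 g8 FINDING «p ≠ 0 in R», lit g44 print check, REF-169 (a)(b)); every printed use is
  characteristic `0` (Thm. 1.6.5 over `ℤ_p` [p0012 L75–90]; §2.1 localisations `S_𝔭`, `𝔭 ≠ pΛ` [p0015 L31, L52]).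
  (2) «How04-2.6.1@(3,−3)-units» — §1.2's «the maximal `p`-subextension of `K[ℓ]_λ/K_λ` (call it `L`) is a maximal
  totally tamely ramified abelian `p`-extension of `K_λ` whose Galois group is canonically identified with the
  `p`-Sylow subgroup of `G_ℓ`» [p0006 L84–92] uses `p ∤ u_K`, `u_K = #𝓞_K^×/2` (`[K[ℓ] : K[1]] = (ℓ + 1)/u_K` for `ℓ`
  inert, Cox Thm. 7.24), i.e. fails exactly at `(p, d_K) = (3, −3)`; Howard imposes «`D ≠ −3, −4`» only where Heegner
  points are built [p0003 L23–25, p0012 L128–130, p0015 L3–5] (REF-167).  For odd `p`, `p ∤ #𝓞_K^×` ⟺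
  `(p, d_K) ≠ (3, −3)` (`#𝓞_K^× ∈ {2, 4, 6}`).
* Every consumer in this tree is inside the intended scope: `R = ℤ_p`, `𝒪_℘`, or the Eisenstein settings
  `Λ/(T^m + p)` (char. `0`), and `d_K ∉ {−3, −4}` (`Thm413Hypotheses.discr_odd/discr_ne`; X9 has `p ≥ 5`)
  (REF-169 (c)).  The G87 engine (kernel road to Thm. 1.6.1: `DVRSettingEngine*`, `CasselsTateSkewPairing*`,
  `InertTransverseDecompositionOfUnits*`, …) carries exactly these two guards, spelled as below.

## Transcription

* Binders = `thm161_dvrKolyvaginBound`'s universals VERBATIM (p, K, R, N, Rk, Nbar, Nq with their instances, `S`, `κ`,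
  `hy : S.SatisfiesH`), then the two guards as printed-proof standing, spelled EXACTLY as the engine files spell them —
  `((p : ℕ) : R) ≠ 0` (`DVRSettingEngineChebProofs` `hp0`) and `¬ p ∣ Nat.card (𝓞 K)ˣ`
  (`InertTransverseDecompositionOfUnitsProofs` `hu`) — then, unchanged, `S.LargePrimes → κ.one ≠ 0 →
  S.Conclusion hy κ.one`.  WEAKER than F-161 (two extra hypotheses), never stronger:
  `thm161_dvrKolyvaginBound_printIntended_of_thm161`.
* Remark on `hu` (cell referee REF-169a (4), for the record): `Nat.card (𝓞 K)ˣ ∈ {2, 4, 6}` only because `K` is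
  imaginary quadratic — which `hy : S.SatisfiesH` carries as its field `imagQuad`; for a general number field the unit
  group is infinite, `Nat.card (𝓞 K)ˣ = 0` and the guard `¬ p ∣ 0` is `False` (a vacuous instance) — harmless here, since
  every instance of the fact already has `hy.imagQuad`.
* Cell bookkeeping (not part of the statement): the routes' binder hH (`HowardDVRKolyvaginBound`, items 23087 / its X10b
  twin) currently := F-161; re-pointing it to F-161′ is the PEN's route edit (REF-169 (d): «re-derive p695713 / p696595 /
  K1 by name, one line per clause; closes text unchanged; REF-149 re-audit»); a kernel theorem
  `thm161_dvrKolyvaginBound_printIntended_holds` from the engine modulo the cite-only inputs {C45.1′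
  `prop141_casselsTate_skewPairing_atLevel`, Čebotarev for Artin representations, Poitou–Tate for Selmer structures}
  would then be a BY-NAME discharge of the rows' leaf (COUNTABLE); until then nothing is re-counted.

References: [Howard2004HeegnerKolyvagin] Thm. 1.6.1 (arXiv Thm. 2.6.1, p0011 L17–32; proof p0011 L33 – p0012 L55),
§1 conventions (p0004 L47–52), §1.2 Def. 1.2.1 and the `p`-Sylow identification (p0006 L57–92), Thm. 1.6.5 (p0012
L75–90), §2.1 (p0015 L28–52); [Cox2013] §7.D Thm. 7.24 (`[K[ℓ] : K[1]]`).
-/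

noncomputable section

open Function NumberField IsDedekindDomain Field IsLocalRing
open scoped NumberField ContRepresentation Classical

namespace Literature.NumberTheory.GaloisCohomology.Howard2004

open Literature.NumberTheory.GaloisRepresentations Literature.NumberTheory.GaloisRepresentations.DiscreteGaloisModule

/-- **Howard 2004, Theorem 1.6.1 as intended by its printed proof (F-161′)** — the statement of
`thm161_dvrKolyvaginBound` (Compositio 140 Thm. 1.6.1 = arXiv:1202.6340 Thm. 2.6.1, p0011 L23–28, verbatim there: «Suppose
there is a Kolyvagin system `κ ∈ KS(T, F, 𝓛)` with `κ_1 ≠ 0`. Then `H¹_F(K, T)` is a free rank-one `R` module, and there is a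
finite `R`-module `M` such that `H¹_F(K, A) ≅ 𝒟 ⊕ M ⊕ M`. Furthermore `len_R(M) ≤ len_R(H¹_F(K, T)/R·κ_1)`») UNDER THE TWO
STANDING CLAUSES ITS PROOF USES: `p ≠ 0` in the DVR coefficient ring `R` («the cases of interest are … `𝒪` …, a quotient
of `𝒪`, or … `Λ`» [p0004 L49–51]; `𝓛_k` keyed by `p^k` [p0006 L69–70] against the levels `R/𝔪^k` [p0011 L36–38] — print gap
«@eqchar», REF-169) and `p ∤ #𝓞_K^×` (§1.2's `p`-Sylow identification of `Gal(K[ℓ]_λ/K_λ)` [p0006 L84–92], failing only at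
`(p, d_K) = (3, −3)` — print gap «@(3,−3)-units», REF-167).  RECORDED AS: for every `DVRSetting` `S` with `S.SatisfiesH`, every
Kolyvagin system `κ`, IF `((p : ℕ) : R) ≠ 0` and `¬ p ∣ Nat.card (𝓞 K)ˣ`, then `S.LargePrimes → κ.one ≠ 0 → S.Conclusion hy κ.one`
— the verbatim fact's body with the two guards inserted after `hy` (spelled as in the G87 engine files).  WEAKER than the
verbatim F-161 (`thm161_dvrKolyvaginBound_printIntended_of_thm161`), = print-as-INTENDED; F-161 stays the record of
print-as-WORDED.  PUBLISHED THEOREM (its printed proof covers exactly this scope).  A `Prop`; nothing asserted.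
[cite: Howard2004HeegnerKolyvagin, Thm. 1.6.1 (arXiv:1202.6340 Thm. 2.6.1, p0011 L17–32; proof p0011 L33 – p0012 L55) with §1 conventions (p0004 L47–52) and §1.2 (p0006 L57–92)] -/
def thm161_dvrKolyvaginBound_printIntended : Prop :=
  ∀ (p : ℕ) [Fact p.Prime] (K : Type) [Field K] [NumberField K]
    (R : Type) [CommRing R] [IsDomain R] [IsDiscreteValuationRing R] [Algebra ℤ_[p] R]
    (N : ℕ → Type) [∀ k, AddCommGroup (N k)] [∀ k, TopologicalSpace (N k)]
    [∀ k, DiscreteTopology (N k)] [∀ k, Module R (N k)]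
    (Rk : ℕ → Type) [∀ k, CommRing (Rk k)] [∀ k, IsLocalRing (Rk k)] [∀ k, TopologicalSpace (Rk k)]
    [∀ k, DiscreteTopology (Rk k)] [∀ k, Algebra ℤ_[p] (Rk k)] [∀ k, Algebra R (Rk k)]
    [∀ k, Module (Rk k) (N k)] [∀ k, IsScalarTower R (Rk k) (N k)]
    (Nbar : Type) [AddCommGroup Nbar] [TopologicalSpace Nbar] [DiscreteTopology Nbar]
    [∀ k, Module (Rk k) Nbar]
    (Nq : ℕ → Finset (HeightOneSpectrum (𝓞 K)) → Type) [∀ k n, AddCommGroup (Nq k n)]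
    [∀ k n, TopologicalSpace (Nq k n)] [∀ k n, DiscreteTopology (Nq k n)]
    [∀ k n, Module (Rk k) (Nq k n)] [∀ k n, Module R (Nq k n)]
    [∀ k n, IsScalarTower R (Rk k) (Nq k n)]
    (S : DVRSetting p K R N Rk Nbar Nq) (κ : S.KolyvaginSystem) (hy : S.SatisfiesH),
    ((p : ℕ) : R) ≠ 0 → ¬ p ∣ Nat.card (𝓞 K)ˣ →
    S.LargePrimes → κ.one ≠ 0 → S.Conclusion hy κ.one

/-- **F-161 ⇒ F-161′**: the print-as-intended statement is a WEAKENING of the verbatim fact (drop the two guards).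
[cite: Howard2004HeegnerKolyvagin, Thm. 1.6.1] -/
theorem thm161_dvrKolyvaginBound_printIntended_of_thm161 (h : thm161_dvrKolyvaginBound) :
    thm161_dvrKolyvaginBound_printIntended :=
  fun p _ K _ _ R _ _ _ _ N _ _ _ _ Rk _ _ _ _ _ _ _ _ Nbar _ _ _ _ Nq _ _ _ _ _ _ S κ hy _ _ hL hone ↦
    h p K R N Rk Nbar Nq S κ hy hL hone

end Literature.NumberTheory.GaloisCohomology.Howard2004

end
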